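import Mathlib
import Summits.AtomisticToContinuum.FouriersLaw.Theses.ParityLiouvilleSeed
import Summits.AtomisticToContinuum.FouriersLaw.Theorems.ParityLiouvilleSeedCesaroUpgradeGrowth
import Summits.AtomisticToContinuum.FouriersLaw.Theorems.ParityLiouvilleSeedCesaroUpgradeWeakLimit
import Summits.AtomisticToContinuum.FouriersLaw.Theorems.ParityLiouvilleSeedCesaroUpgradeCesaro
import Summits.AtomisticToContinuum.FouriersLaw.Theorems.ParityLiouvilleSeedCesaroUpgradeEntropyLimit
import Summits.AtomisticToContinuum.FouriersLaw.Theorems.ParityLiouvilleSeedCesaroUpgradeContinuity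
import HarnessLib

/-!
# `CesaroUpgrade`: zero-current rigidity of shift-invariant states gives the Liouville theorem for heat

Closes item `stmt-AtomisticToContinuum-13981` of route `ParityLiouvilleSeed`
(`Summit.AtomisticToContinuum.FouriersLaw.Theses.ParityLiouvilleSeed.CesaroUpgrade`,
i.e. `ZeroCurrentRigidity → LiouvilleForHeat`).

Proof (Cesàro averaging over translations). Let `ν` be a time-invariant probability measure of
the infinite pinned chain with site-uniform moments of all orders, uniformly regular w.r.t. a
shift-invariant Gibbs state `μ_T` (`H(ν|_Λ | μ_T|_Λ) ≤ C|Λ|` for all boxes), with `j₀ ∈ L¹(ν)`.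
1. BOND INDEPENDENCE (`…Continuity`): `∫ j₀ ∘ τ^k dν = ∫ j₀ dν` for all `k`
   (continuity equation `𝒜e_x = j_{x-1} - j_x`, cut-off lemma).
2. CESÀRO AVERAGES `ν_n = (n+1)⁻¹ ∑_{k ≤ n} ν ∘ τ^{-k}` (`…Cesaro`): time invariant, same site
   moments, `∫ j₀ dν_n = ∫ j₀ dν`; tight, so (PROKHOROV) they converge along an ultrafilter to a
   SHIFT-INVARIANT probability measure `ν̄`.
3. `ν̄` inherits the moments (Fatou), time invariance and `∫ j₀ dν̄ = ∫ j₀ dν` (uniform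
   integrability from moments, `…WeakLimit`, with the growth bounds of `…Growth`), and regularity
   with the same constant (entropy inequality for each `ν ∘ τ^{-k}` box by box — the reference is
   shift invariant —, averaged, passed to the limit, and converted back by the hard half of
   Donsker–Varadhan: `…Entropy`, `…EntropyLimit`).
4. `ZeroCurrentRigidity` applied to `ν̄` gives `∫ j₀ dν̄ = 0`, hence `∫ j₀ dν = 0`.
-/

noncomputable section

namespace Summit.AtomisticToContinuum.FouriersLaw.Theorems

open MeasureTheory Filter Topology Set BoundedContinuousFunction InformationTheory
open scoped ENNReal
open Literature.MathematicalPhysics.KineticTheory.HeatConduction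
open Summit.AtomisticToContinuum.FouriersLaw.Theorems.CesaroUpgrade

namespace CesaroUpgrade

/-! ### Last helpers -/

/-- `𝒜f` is continuous for a local test function `f` (pinned chain). [folklore] -/
theorem continuous_liouvilleZ_of_isLocalTestFunction (ω₂ lam β γ : ℝ) {f : ChainConfig → ℝ}
    (hf : IsLocalTestFunction f) : Continuous (liouvilleZ (pinnedChain ω₂ lam β γ) f) := by
  obtain ⟨R, g, hg, -, -, rfl⟩ := hf
  have heq : liouvilleZ (pinnedChain ω₂ lam β γ) (g ∘ boxRestrict R) = fun σ => ∑ i : Fin (2 * R + 1),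
      ((σ ((i : ℤ) - R)).2 * fderiv ℝ g (boxRestrict R σ) (Pi.single i (1, 0)) +
        (pinnedChain ω₂ lam β γ).force σ ((i : ℤ) - R) *
          fderiv ℝ g (boxRestrict R σ) (Pi.single i (0, 1))) :=
    funext fun σ => liouvilleZ_comp_boxRestrict _ R σ ((hg.differentiable one_ne_zero) _)
  rw [heq]
  have hD : ∀ v : Fin (2 * R + 1) → ℝ × ℝ,
      Continuous fun σ : ChainConfig => fderiv ℝ g (boxRestrict R σ) v := fun v =>
    ((ContinuousLinearMap.apply ℝ ℝ v).continuous.comp (hg.continuous_fderiv one_ne_zero)).comp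
      (continuous_boxRestrict R)
  refine continuous_finsetSum _ fun i _ => ?_
  have hp : Continuous fun σ : ChainConfig => (σ ((i : ℤ) - R)).2 :=
    (continuous_apply _).snd
  exact (hp.mul (hD _)).add ((continuous_pinnedChain_force ω₂ lam β γ _).mul (hD _))

/-- Second moments of a growth-bounded observable from site moments of order `2d`. [folklore] -/
theorem sq_integral_le_of_growth {ν : Measure ChainConfig} [IsProbabilityMeasure ν]
    {g : ChainConfig → ℝ} {R d : ℕ} {K C : ℝ}
    (hg : ∀ σ, |g σ| ≤ K * (1 + ‖boxRestrict R σ‖) ^ d) (hmeas : AEStronglyMeasurable g ν)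
    (hmom : ∀ x : ℤ, Integrable (fun σ : ChainConfig => |(σ x).1| ^ (2 * d) + |(σ x).2| ^ (2 * d)) ν ∧
      ∫ σ, (|(σ x).1| ^ (2 * d) + |(σ x).2| ^ (2 * d)) ∂ν ≤ C) :
    Integrable (fun σ => g σ ^ 2) ν ∧
      ∫ σ, g σ ^ 2 ∂ν ≤ K ^ 2 * (2 ^ (2 * d) * (1 + (2 * R + 1) * C)) := by
  have hsq : ∀ σ, |g σ ^ 2| ≤ K ^ 2 * (1 + ‖boxRestrict R σ‖) ^ (2 * d) := fun σ => by
    rw [abs_of_nonneg (sq_nonneg _), ← sq_abs, pow_mul', ← mul_pow]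
    exact pow_le_pow_left₀ (abs_nonneg _) (hg σ) 2
  obtain ⟨hint, hle⟩ := integrable_of_abs_le_growth hsq (hmeas.pow 2) hmom
  refine ⟨hint, le_trans (le_of_eq ?_) hle⟩
  exact integral_congr_ae (Eventually.of_forall fun σ => (abs_of_nonneg (sq_nonneg _)).symm)

/-- Box marginals of shifted measures: `(ν ∘ τ^{-k})|_{a,n} = ν|_{a+k,n}`. [folklore] -/
theorem boxMarginal_map_shift_iterate (a : ℤ) (n k : ℕ) (ν : Measure ChainConfig) :
    boxMarginal a n (ν.map (shift^[k])) = boxMarginal (a + k) n ν := by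
  unfold boxMarginal
  rw [Measure.map_map (boxRestrictAt_measurable a n) (measurable_shift_iterate k)]
  congr 1
  funext σ i
  simp only [Function.comp_apply, boxRestrictAt_apply, shift_iterate_apply]
  congr 1; ring

/-- Shift-invariant measures are invariant under iterated shifts. [folklore] -/
theorem map_shift_iterate_of_isShiftInvariant {μ : Measure ChainConfig} (h : IsShiftInvariant μ) (k : ℕ) :
    μ.map (shift^[k]) = μ := by
  induction k with
  | zero => simp
  | succ k ih =>
    rw [Function.iterate_succ', ← Measure.map_map shift_measurable (measurable_shift_iterate k), ih]
    exact h

/-- **Donsker–Varadhan inequalities for the box marginals of the Cesàro averages**: uniform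
regularity of `ν` w.r.t. a SHIFT-INVARIANT reference passes, box by box and with the same
constant, to every Cesàro average (entropy inequality for each shifted measure, then average).
[folklore] -/
theorem cesaro_box_dv_le {ν μT : Measure ChainConfig} [IsProbabilityMeasure ν] [IsProbabilityMeasure μT]
    (hSI : IsShiftInvariant μT) {C : ℝ≥0∞} (hC : C ≠ ⊤)
    (hreg : ∀ (a : ℤ) (n : ℕ), klDiv (boxMarginal a n ν) (boxMarginal a n μT) ≤ C * (n + 1))
    (N : ℕ) (a : ℤ) (n : ℕ) (φ : (Fin (n + 1) → ℝ × ℝ) →ᵇ ℝ) :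
    ∫ y, φ y ∂(boxMarginal a n
        (((N : ℝ≥0∞) + 1)⁻¹ • ∑ k ∈ Finset.range (N + 1), ν.map (shift^[k]))) -
      Real.log (∫ y, Real.exp (φ y) ∂(boxMarginal a n μT)) ≤ (C * (n + 1)).toReal := by
  have hCn : C * (n + 1) ≠ ⊤ := ENNReal.mul_ne_top hC (by simp)
  have hφm : Measurable (φ ∘ boxRestrictAt a n) := φ.continuous.measurable.comp (boxRestrictAt_measurable a n)
  have hφb : ∀ σ, |(φ ∘ boxRestrictAt a n) σ| ≤ ‖φ‖ := fun σ => by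
    rw [Function.comp_apply, ← Real.norm_eq_abs]; exact φ.norm_coe_le_norm _
  have hint : ∀ k : ℕ, Integrable ((φ ∘ boxRestrictAt a n) ∘ shift^[k]) ν := fun k =>
    Integrable.of_bound ((hφm.comp (measurable_shift_iterate k)).aestronglyMeasurable) ‖φ‖
      (Eventually.of_forall fun σ => by rw [Real.norm_eq_abs]; exact hφb _)
  haveI := isProbabilityMeasure_cesaro ν N
  rw [boxMarginal, integral_map (boxRestrictAt_measurable a n).aemeasurable
    φ.continuous.aestronglyMeasurable]
  have h := (integral_cesaro N hφm hint).2
  simp only [Function.comp_apply] at h ⊢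
  rw [h]
  -- each shifted term obeys the entropy inequality with the same reference
  have hterm : ∀ k : ℕ, ∫ σ, φ (boxRestrictAt a n ((shift^[k]) σ)) ∂ν ≤
      Real.log (∫ y, Real.exp (φ y) ∂(boxMarginal a n μT)) + (C * (n + 1)).toReal := by
    intro k
    have h1 : ∫ σ, φ (boxRestrictAt a n ((shift^[k]) σ)) ∂ν = ∫ y, φ y ∂(boxMarginal (a + k) n ν) := by
      rw [← boxMarginal_map_shift_iterate, boxMarginal, Measure.map_map (boxRestrictAt_measurable a n)
        (measurable_shift_iterate k), integral_map ((boxRestrictAt_measurable a n).comp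
        (measurable_shift_iterate k)).aemeasurable φ.continuous.aestronglyMeasurable]
      rfl
    have h2 : boxMarginal a n μT = boxMarginal (a + k) n μT := by
      rw [← boxMarginal_map_shift_iterate, map_shift_iterate_of_isShiftInvariant hSI]
    rw [h1, h2]
    have := integral_boundedContinuous_sub_log_le hCn (hreg (a + k) n) φ
    linarith
  calc ((N : ℝ) + 1)⁻¹ * ∑ k ∈ Finset.range (N + 1), ∫ σ, φ (boxRestrictAt a n ((shift^[k]) σ)) ∂ν -
        Real.log (∫ y, Real.exp (φ y) ∂(boxMarginal a n μT))
      ≤ ((N : ℝ) + 1)⁻¹ * ∑ _k ∈ Finset.range (N + 1),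
          (Real.log (∫ y, Real.exp (φ y) ∂(boxMarginal a n μT)) + (C * (n + 1)).toReal) -
        Real.log (∫ y, Real.exp (φ y) ∂(boxMarginal a n μT)) := by
        gcongr with k
        exact hterm k
    _ = (C * (n + 1)).toReal := by
        rw [Finset.sum_const, Finset.card_range, nsmul_eq_mul]; push_cast; field_simp; ring

end CesaroUpgrade

/-! ### The theorem -/

/-- **`CesaroUpgrade` holds**: zero-current rigidity of the shift-invariant, time-invariant,
regular states of the infinite pinned chain implies the Liouville theorem for heat (no
shift invariance assumed; translation-bounded moments and uniform regularity w.r.t. a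
shift-invariant Gibbs state instead), by Cesàro averaging over translations, Prokhorov
compactness, lower semicontinuity of the relative entropy and bond independence of the mean
current. [folklore] -/
theorem cesaroUpgrade_proof :
    Summit.AtomisticToContinuum.FouriersLaw.Theses.ParityLiouvilleSeed.CesaroUpgrade := by
  intro hZ ω₂ lam β γ hω hl hβ ν hprob hTI hMom hReg hInt
  obtain ⟨T, μT, hT, hGibbs, hSI, C, hCtop, hCreg⟩ := hReg
  haveI : IsProbabilityMeasure μT := hGibbs.isProbabilityMeasure
  choose Cm hCm using hMom
  -- Cesàro averages and a shift-invariant cluster point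
  obtain ⟨c, ν', U, hc, hU, hlim, hshift⟩ := exists_cesaro_clusterPt ν (hCm 2)
  have hcTI : ∀ N, IsTimeInvariant (pinnedChain ω₂ lam β γ) (c N : Measure ChainConfig) := fun N => by
    rw [hc N]; exact isTimeInvariant_cesaro hTI N
  have hcmom : ∀ (m N : ℕ) (x : ℤ),
      Integrable (fun σ : ChainConfig => |(σ x).1| ^ m + |(σ x).2| ^ m) (c N : Measure ChainConfig) ∧
        ∫ σ, (|(σ x).1| ^ m + |(σ x).2| ^ m) ∂(c N : Measure ChainConfig) ≤ Cm m := fun m N x => by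
    rw [hc N]; exact site_moment_cesaro (hCm m) N x
  -- (1) moments of the limit
  have hmom' : ∀ m : ℕ, ∃ C : ℝ, ∀ x : ℤ,
      Integrable (fun σ : ChainConfig => |(σ x).1| ^ m + |(σ x).2| ^ m) (ν' : Measure ChainConfig) ∧
        ∫ σ, (|(σ x).1| ^ m + |(σ x).2| ^ m) ∂(ν' : Measure ChainConfig) ≤ C := fun m =>
    ⟨Cm m, fun x => integrable_of_tendsto_of_integral_le hlim
      (g := fun σ : ChainConfig => |(σ x).1| ^ m + |(σ x).2| ^ m) (by fun_prop)
      (fun σ => by positivity) fun N => hcmom m N x⟩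
  -- (2) time invariance of the limit
  have hTI' : IsTimeInvariant (pinnedChain ω₂ lam β γ) (ν' : Measure ChainConfig) := by
    intro f hf
    obtain ⟨R, K, -, hle⟩ := exists_abs_liouvilleZ_le_growth ω₂ lam β γ hf
    have hcont := continuous_liouvilleZ_of_isLocalTestFunction ω₂ lam β γ hf
    have hsq := fun N => sq_integral_le_of_growth (d := 3) hle hcont.aestronglyMeasurable (hcmom 6 N)
    obtain ⟨hint', -, -, hconv⟩ := tendsto_integral_of_tendsto_of_sq_le hlim hcont hsq
    refine ⟨hint', ?_⟩
    have h0 : (fun N => ∫ σ, liouvilleZ (pinnedChain ω₂ lam β γ) f σ ∂(c N : Measure ChainConfig)) =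
        fun _ => 0 := funext fun N => ((hcTI N) f hf).2
    rw [h0] at hconv
    exact (tendsto_nhds_unique tendsto_const_nhds hconv).symm
  -- (3) regularity of the limit
  have hReg' : IsRegular (pinnedChain ω₂ lam β γ) (ν' : Measure ChainConfig) := by
    refine ⟨T, μT, hT, hGibbs, C, hCtop, fun a n => ?_⟩
    have hbox : Continuous (boxRestrictAt a n) := continuous_boxRestrictAt a n
    have hlim_box := ProbabilityMeasure.tendsto_map_of_tendsto_of_continuous c ν' hlim hbox
    have hCn : C * (n + 1) ≠ ⊤ := ENNReal.mul_ne_top hCtop (by simp)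
    have key := klDiv_le_of_tendsto hlim_box (boxMarginal a n μT) (r := (C * (n + 1)).toReal)
      fun N φ => by
        rw [ProbabilityMeasure.toMeasure_map, hc N]
        exact cesaro_box_dv_le hSI hCtop hCreg N a n φ
    rw [ProbabilityMeasure.toMeasure_map, ENNReal.ofReal_toReal hCn] at key
    exact key
  -- (4) the current
  have hj : ∀ σ, |(pinnedChain ω₂ lam β γ).bondCurrentZ σ 0| ≤ (2 + 8 * |β|) * (1 + ‖boxRestrict 1 σ‖) ^ 4 :=
    fun σ => abs_pinnedChain_bondCurrentZ_le ω₂ lam β γ (R := 1) (x := 0) (by simp) σ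
  have hjcont := continuous_pinnedChain_bondCurrentZ ω₂ lam β γ 0
  have hsq0 := fun N => sq_integral_le_of_growth (d := 4) hj hjcont.aestronglyMeasurable (hcmom 8 N)
  obtain ⟨hint0, -, -, hconv0⟩ := tendsto_integral_of_tendsto_of_sq_le hlim hjcont hsq0
  have hmomν : ∀ m : ℕ, ∃ C : ℝ, ∀ x : ℤ,
      Integrable (fun σ : ChainConfig => |(σ x).1| ^ m + |(σ x).2| ^ m) ν ∧
        ∫ σ, (|(σ x).1| ^ m + |(σ x).2| ^ m) ∂ν ≤ C := fun m => ⟨Cm m, hCm m⟩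
  have hcI : ∀ N, ∫ σ, (pinnedChain ω₂ lam β γ).bondCurrentZ σ 0 ∂(c N : Measure ChainConfig) =
      ∫ σ, (pinnedChain ω₂ lam β γ).bondCurrentZ σ 0 ∂ν := by
    intro N
    rw [hc N]
    refine integral_cesaro_eq_of_forall_eq N hjcont.measurable (fun k => ?_)
      (integral_bondCurrentZ_comp_shift_iterate ω₂ lam β γ hTI hmomν)
    have hk : ∀ σ, |((fun σ => (pinnedChain ω₂ lam β γ).bondCurrentZ σ 0) ∘ shift^[k]) σ| ≤
        (2 + 8 * |β|) * (1 + ‖boxRestrict (k + 1) σ‖) ^ 4 := fun σ => by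
      simp only [Function.comp_apply, bondCurrentZ_shift_iterate, zero_add]
      exact abs_pinnedChain_bondCurrentZ_le ω₂ lam β γ (R := k + 1) (x := k) (by simp) σ
    exact (integrable_of_abs_le_growth hk
      ((hjcont.comp (continuous_shift_iterate k)).aestronglyMeasurable) (hCm 4)).1
  have hconst : (fun N => ∫ σ, (pinnedChain ω₂ lam β γ).bondCurrentZ σ 0 ∂(c N : Measure ChainConfig)) =
      fun _ => ∫ σ, (pinnedChain ω₂ lam β γ).bondCurrentZ σ 0 ∂ν := funext hcI
  rw [hconst] at hconv0
  have heq : ∫ σ, (pinnedChain ω₂ lam β γ).bondCurrentZ σ 0 ∂ν =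
      ∫ σ, (pinnedChain ω₂ lam β γ).bondCurrentZ σ 0 ∂(ν' : Measure ChainConfig) :=
    tendsto_nhds_unique tendsto_const_nhds hconv0
  -- (5) zero-current rigidity of the limit
  rw [heq]
  exact hZ ω₂ lam β γ hω hl hβ ν' ν'.prop hshift hTI' hReg' hint0

end Summit.AtomisticToContinuum.FouriersLaw.Theorems

end
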